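import Literature.NumberTheory.Automorphic.CDTTheorem722SerreProofs
import Literature.NumberTheory.EllipticCurves.AnalyticRankModularityProofs
import HarnessLib

/-!
# `L(E, s)` is entire: Serre's road to `WeierstrassCurve.hasEntireLFunction_rat`
# (Serre 1987, §4.6, Théorème 4, with Khare–Wintenberger), without Carayol's theorem

A `…Proofs` sibling (theorems only: no definition, no named fact, no instance, no `sorry`) of
`Literature.NumberTheory.EllipticCurves.AnalyticRank`, written by the tenured seat of the named
fact `WeierstrassCurve.hasEntireLFunction_rat` ("for every elliptic curve `E / ℚ`, `L(E, s)` is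
the restriction to `re s > 3/2` of an entire function"; Breuil–Conrad–Diamond–Taylor 2001, Thm. A
with Hecke; Diamond–Shurman Thm. 8.8.3 / Thm. 5.10.2).

The earlier siblings record the trust base of this fact along the printed proof of BCDT Thm. A
(`AnalyticRankBCDTProofs`: {BCDT Thm. B, CDT Thm. 7.2.4}; `AnalyticRankBCDTTheoremBProofs`: the
five finest statable leaves of BCDT §2.2; `AnalyticRankKhareWintenbergerProofs`:
{`khare_wintenberger 5 k`, `CDT_theorem_7_2_4`}).  Every one of those lines contains a modularity
*lifting* theorem (Wiles, Taylor–Wiles, Diamond, Conrad–Diamond–Taylor, BCDT).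

Since `Literature.NumberTheory.Automorphic.CDTTheorem722SerreProofs` (2026-08-15) the tree also
holds **Serre's road** to Theorem A — Serre, *Sur les représentations modulaires de degré `2` de
`Gal(ℚ̄/ℚ)`*, Duke Math. J. 54 (1987), §4.6:

> **THÉORÈME 4.** *Admettons (3.3.1_?). Alors `E` est une courbe de Weil de niveau `N`.*

whose printed proof (Lemme 5: (4.6.2) `ρ_p^E` irreducible for `p ≥ C_E` — Mazur —, (4.6.3) its
conductor `N_p` divides `N` "(ce qui d'ailleurs suffirait pour la suite)"; (3.3.1_?) and the
Deligne–Serre lift (3.1.6) give an eigenform `F` of weight `2` and level `N` with `F̃ = f_p`;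
"il n'y a qu'un nombre fini de `F` possibles, puisque le poids et le niveau sont fixés", so one
`F` serves an infinite set `P` of primes; "l'entier algébrique `A_l - a_l` a une image dans `𝔽̄_p`
qui est égale à `0` pour tout `p ∈ P`, `p ≠ l`. Comme `P` est infini, cela entraîne
(4.6.4) `A_l = a_l` pour tout `l ∤ N`"; "les `A_l` appartiennent à `ℤ`. Ils définissent une courbe
de Weil `E_F` de niveau un diviseur de `N`; … les représentations `l`-adiques attachées à `E` et
`E_F` sont isomorphes, et l'on sait (Faltings) que cela entraîne que `E` et `E_F` sont isogènes
sur `ℚ`. D'où le th. 4.") uses **no lifting theorem**: its inputs are Serre's conjecture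
(3.3.1_?) = (3.2.4_?) for `k = 2`, `ε = 1` — now the theorem of Khare–Wintenberger (Invent.
Math. 178 (2009), Thms. 1.2 and 9.1; §10, Thm. 10.1 (i) and the remark following its proof:
"Part (i) combined with Faltings' isogeny theorem yields modularity of abelian varieties of
`GL₂`-type over `ℚ`"), the weight and the level of `ρ̄_{E,p}`, Eichler–Shimura and Faltings;
Carayol's theorem enters only through *Remarque (2)* ("La forme `F` construite dans la
démonstration ci-dessus est primitive; cela résulte d'un théorème de Carayol"), i.e. only to pin
the level of `F` to `N` exactly.

**For the entire continuation of `L(E, s)` the level of `F` is irrelevant**: any cusp form of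
weight `2` on any `Γ₀(M)` with `aₙ(F) = aₙ(E)` for all `n` makes `L(E, s) = L(F, s)` entire by
Hecke (`WeierstrassCurve.hasEntireLFunction_of_cuspCoeff_eq`, strict width `1` at `∞`).  This
file therefore re-runs the tree's formalisation of Serre's proof
(`BCDT.isModular_of_forall_isTorsionGaloisRep_exists_isNewform1_of_three_facts`, whose conclusion
`IsModular W` has the level pinned to `N_E` and accordingly consumes Carayol) with the conclusion
Serre actually reaches before Remarque (2) — a `Γ₀(n₀)`-newform `g₀`, `n₀ ≤ N_E`, with
`a_q(g₀) = a_q(E)` for all primes `q ∤ n₀ N_E`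
(`exists_isNewform0_cuspCoeff_eq_off_of_forall_isTorsionGaloisRep_exists_isNewform1`, Steps 0–5
of that proof, verbatim, **no named fact used**) — and ends it without Carayol
(`isNewformOf_of_isNewform0_of_cuspCoeff_eq_off_of_eichlerShimura_of_faltings`: Eichler–Shimura
curve `E_{g₀}`, Faltings, isogeny invariance of `L`, hence `aₙ(g₀) = aₙ(E)` for **all** `n`, at
level `n₀`).  Consequently the trust base of `hasEntireLFunction_rat` along Serre's road is

  {`khare_wintenberger p k` for all primes `p ≥ p₀` (Khare–Wintenberger 2009),
   the Serre weight `k(ρ̄_{E,p} ⊗ k) = 2` and the Serre level `N(ρ̄_{E,p} ⊗ k) ∣ N_E` of the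
   `p`-torsion of `E` for large `p` (hypotheses `hwt`, `hlev`, exactly as in
   `CDTTheorem722SerreProofs`: Serre 1987 §2.8 Prop. 4 and (4.6.3); not named facts),
   `eichlerShimuraConstruction` (Eichler–Shimura), `WeierstrassCurve.isIsogenous_iff_frobeniusTrace_eq`
   (Faltings 1983)}

(`WeierstrassCurve.hasEntireLFunction_rat_of_khare_wintenberger_of_serreWeight_of_serreLevel_of_eichlerShimura_of_faltings`),
one named fact (`IsNewformOf.level_eq_conductorNorm`, Carayol) fewer than the trust base of the
Modularity Theorem `exists_isNewformOf` itself along the same road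
(`BCDT.exists_isNewformOf_of_khare_wintenberger_of_serreWeight_of_serreLevel_of_three_facts`,
composed here for the record as `…_of_three_facts`), and with no modularity lifting theorem.
Irreducibility of `E[p]` for large `p` ((4.6.2); Serre cites Mazur) and `det ρ̄_{E,p} = χ̄_p`
((4.6.1), Weil pairing) are theorems of the tree and enter through
`BCDT.forall_isTorsionGaloisRep_exists_isNewform1_of_khare_wintenberger`.

No statement of `AnalyticRank.lean` is changed and no named fact is introduced (net debt
delta 0).  What remains for the unconditional `hasEntireLFunction_rat_holds` along this road is
{`khare_wintenberger`, `eichlerShimuraConstruction`, `isIsogenous_iff_frobeniusTrace_eq`} and the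
two local statements `hwt`, `hlev` (Raynaud's `(p, p)` classification; the Artin conductor of
`E[p]` versus `N_E`), none of which is formalised anywhere.

## References

* [Serre1987] J.-P. Serre, *Sur les représentations modulaires de degré `2` de `Gal(ℚ̄/ℚ)`*, Duke
  Math. J. 54 (1987), 179–230 = Œuvres IV, no. 143: §4.6, Théorème 4, Lemme 5 ((4.6.1)–(4.6.4)),
  Remarques (1)–(2) (read in Œuvres IV).
* [KhareWintenberger2009] C. Khare, J.-P. Wintenberger, *Serre's modularity conjecture (I)*,
  Invent. Math. 178 (2009), 485–504: Thm. 1.2, Thm. 9.1; §10, Thm. 10.1 (i) and the remark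
  after its proof (PDF p. 19).
* [Faltings1983Endlichkeit] G. Faltings, Invent. Math. 73 (1983), §5, Korollar 2.
* [BCDTJAMS2001] C. Breuil, B. Conrad, F. Diamond, R. Taylor, J. Amer. Math. Soc. 14 (2001):
  Theorem A (p. 843) and Introduction p. 845, conditions (1)–(2).
* [DiamondShurman2005] F. Diamond, J. Shurman, *A First Course in Modular Forms*, GTM 228:
  Thm. 5.10.2, Thm. 8.8.3 and the paragraph following it, Thm. 9.6.11.

## Design

Theorems only; `noncomputable section`; same conventions as `CDTTheorem722SerreProofs`
(coefficient fields of characteristic `p` carried as data inside the hypotheses; `𝔽̄_p` with the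
discrete topology).  The statements in `namespace WeierstrassCurve` are declared with `_root_.`
from inside `namespace Literature.NumberTheory.Automorphic.BCDT` so that the hypotheses elaborate
in the same context as the tree's Serre-road theorems.  Axioms: `propext`, `Classical.choice`,
`Quot.sound`.
-/

noncomputable section

open scoped MatrixGroups ModularForm NumberField
open CongruenceSubgroup UpperHalfPlane Polynomial

namespace Literature.NumberTheory.Automorphic.BCDT

open WeierstrassCurve GaloisRepresentations EllipticCurves EllipticCurves.ModularForms
  Rat.HeightOneSpectrum IsDedekindDomain IsDedekindDomain.HeightOneSpectrum

/-! ## Part A. The last paragraph of Serre's proof without Remarque (2) (no Carayol) -/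

/-- **From a newform `g ∈ S₂(Γ₀(N))` with `a_q(g) = a_q(E)` for all primes `q ∤ N R` to
`aₙ(g) = aₙ(E)` for all `n` — at level `N`, granted Eichler–Shimura (`hES`) and Faltings (`hF`)
only.**  This is the last paragraph of Serre's proof of Théorème 4 (Duke Math. J. 54 (1987),
§4.6) *as printed*, stopping before Remarque (2): the `a_q(g)`, `q` prime, are integers (rational
off `N R`, hence all of them, `IsNewform0.exists_int_eq_coeff_prime_of_off` with Deligne–Serre
(2.7.2) proved, `span_integralLattice1_two`), so are all `aₙ(g)` (`IsNewform0.exists_int_eq_cuspCoeff`);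
"Ils définissent une courbe de Weil `E_F` de niveau un diviseur de `N`" (`hES`: a curve `E_g`
with `aₙ(g) = aₙ(E_g)` for all `n`); "les représentations `l`-adiques attachées à `E` et `E_F`
sont isomorphes, et l'on sait (Faltings) que cela entraîne que `E` et `E_F` sont isogènes sur `ℚ`"
(`WeierstrassCurve.isIsogenous_of_finite_setOf_LFunction_ne`, `hF`), whence
`aₙ(E) = aₙ(E_g) = aₙ(g)` for every `n` (`IsIsogenous.LFunction_eq`, isogeny invariance of `L`,
proved in the tree).  Compared with
`isModular_of_isNewform0_of_cuspCoeff_eq_off_of_three_facts`, Carayol's theorem (`N = N_E`) is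
not used and the conclusion keeps the level `N` of `g`.
[cite: Serre1987, §4.6, proof of Théorème 4 (last paragraph)] -/
theorem isNewformOf_of_isNewform0_of_cuspCoeff_eq_off_of_eichlerShimura_of_faltings
    (hES : eichlerShimuraConstruction)
    (hF : WeierstrassCurve.isIsogenous_iff_frobeniusTrace_eq)
    (W : WeierstrassCurve ℚ) [W.IsElliptic] {N : ℕ} [NeZero N]
    {g : CuspForm (Gamma0 N) 2} (hg : IsNewform0 g) {R : ℕ} [NeZero R]
    (h : ∀ q : ℕ, q.Prime → ¬ q ∣ N * R → cuspCoeff g q = (W.LFunction q : ℂ)) :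
    IsNewformOf W g := by
  classical
  -- all Fourier coefficients of `g` are integers
  have hprime : ∀ q : ℕ, q.Prime → ∃ z : ℤ, (z : ℂ) = (qExpansion 1 ⇑g).coeff q :=
    hg.exists_int_eq_coeff_prime_of_off (by norm_num) (span_integralLattice1_two N) (R := R)
      fun q hq hqM ↦ ⟨W.LFunction q, by rw [Rat.cast_intCast]; exact (h q hq hqM).symm⟩
  have hint : ∀ n : ℕ, ∃ z : ℤ, cuspCoeff g n = z := hg.exists_int_eq_cuspCoeff (by norm_num) hprime
  haveI : NeZero (N * R) := ⟨mul_ne_zero (NeZero.ne N) (NeZero.ne R)⟩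
  -- the Eichler–Shimura curve `E_g` and Faltings: `E ~ E_g`
  obtain ⟨W', hW', hW'g, -⟩ := hES hg hint
  have hiso : IsIsogenous W W' := by
    refine WeierstrassCurve.isIsogenous_of_finite_setOf_LFunction_ne hF W W' ?_
    refine (N * R).primeFactors.finite_toSet.subset ?_
    rintro q ⟨hq, hne⟩
    refine (Nat.mem_primeFactors_of_ne_zero (NeZero.ne _)).mpr ⟨hq, ?_⟩
    by_contra hqM
    exact hne (by exact_mod_cast (h q hq hqM).symm.trans (hW'g.2 q))
  -- `aₙ(E) = aₙ(E_g) = aₙ(g)` for all `n`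
  exact ⟨hg, fun n ↦ by rw [hW'g.2 n, hiso.LFunction_eq]⟩

/-- **… hence `L(E, s)` is entire** (Hecke: `L(E, s) = L(g, s)` coefficientwise for the cusp form
`g ∈ S₂(Γ₀(N))`, `Γ₀(N)` of strict width `1` at `∞`; `WeierstrassCurve.hasEntireLFunction_of_cuspCoeff_eq`,
Diamond–Shurman Thm. 5.10.2 with Rankin's abscissa `3/2`).  Inputs: Eichler–Shimura, Faltings;
no Carayol, no level condition.
[cite: Serre1987, §4.6, proof of Théorème 4 (last paragraph)]
[cite: DiamondShurman2005, Thm. 5.10.2 and §8.8 (after Thm. 8.8.3)] -/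
theorem hasEntireLFunction_of_isNewform0_of_cuspCoeff_eq_off_of_eichlerShimura_of_faltings
    (hES : eichlerShimuraConstruction)
    (hF : WeierstrassCurve.isIsogenous_iff_frobeniusTrace_eq)
    (W : WeierstrassCurve ℚ) [W.IsElliptic] {N : ℕ} [NeZero N]
    {g : CuspForm (Gamma0 N) 2} (hg : IsNewform0 g) {R : ℕ} [NeZero R]
    (h : ∀ q : ℕ, q.Prime → ¬ q ∣ N * R → cuspCoeff g q = (W.LFunction q : ℂ)) :
    W.HasEntireLFunction :=
  W.hasEntireLFunction_of_cuspCoeff_eq (strictWidthInfty_Gamma0 _) g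
    (isNewformOf_of_isNewform0_of_cuspCoeff_eq_off_of_eichlerShimura_of_faltings hES hF W hg h).2

/-! ## Part B. Serre's Théorème 4 up to its last paragraph: a `Γ₀(n₀)`-newform, `n₀ ≤ M`, with
`a_q = a_q(E)` off `n₀ N_E` — no named fact -/

/-- **Serre's proof of Théorème 4, Steps 0–5, unconditionally.**  Let `W / ℚ` be elliptic and
suppose that for all primes `p ≥ p₀` every framed model `ρ̄` of `E[p]` becomes, after extension of
scalars to a field of characteristic `p`, attached modulo a prime above `p` to a newform
`f_p ∈ S₂(Γ₁(N_p))` with `N_p ≤ M` (`IsGaloisRepOfNewform1Int`; the shape in which the tree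
states Serre's conjecture, the lift (3.1.6) built in).  Then there are a level `n₀ ≤ M` and a
newform `g₀ ∈ S₂(Γ₀(n₀))` with `a_q(g₀) = a_q(E)` for every prime `q ∤ n₀ N_E`.
This is the proof of `isModular_of_forall_isTorsionGaloisRep_exists_isNewform1_of_three_facts`
(`CDTTheorem722SerreProofs`, Part E) verbatim up to its Step 5 — `ε_{f_p} = 1` for `p > M`
(`nebentypus_apply_eq_one_of_map_coeff_zero_eq`, `nebentypus_eq_one_of_forall_prime`), descent
to `Γ₀(N_p)` (`exists_isNewform0_coe_eq_of_nebentypus_eq_one`), "il n'y a qu'un nombre fini de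
`F` possibles" (pigeonhole over `finite_newforms0_holds` at the levels `≤ M`), the congruences
`a_q(g₀) ≡ a_q(E)` from `char(Frob_q | E[p]) = X² - a_q(E) X + q`
(`charpoly_baseChange_of_isTorsionGaloisRep`) and "(4.6.4) `A_l = a_l` pour tout `l ∤ N`"
(`eq_zero_of_isIntegral_of_forall_exists_map_eq_zero`) — with the existential conclusion made
explicit, so that different endings (with or without Carayol) can be attached.  No named fact is
used. [cite: Serre1987, §4.6, Théorème 4 and its proof (Lemme 5, (4.6.4))] -/
theorem exists_isNewform0_cuspCoeff_eq_off_of_forall_isTorsionGaloisRep_exists_isNewform1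
    (W : WeierstrassCurve ℚ) [W.IsElliptic] (M p₀ : ℕ)
    (h : ∀ (p : ℕ) [Fact p.Prime], p₀ ≤ p →
      ∀ ρ : ModPGaloisRep ℚ (ZMod p) 2, W.IsTorsionGaloisRep p ρ →
        ∃ (N : ℕ) (_ : NeZero N) (_ : N ≤ M) (f : CuspForm (Gamma1 N) 2)
          (K : Type) (_ : Field K) (_ : CharP K p) (_ : TopologicalSpace K)
          (j : ZMod p →+* K) (ι : coeffCharIntegers f →+* K),
          IsNewform1 f ∧
            IsGaloisRepOfNewform1Int f ι {q | q ∣ N * p}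
              (FramedRep.baseChange j continuous_of_discreteTopology ρ)) :
    ∃ (n₀ : ℕ) (_ : NeZero n₀) (_ : n₀ ≤ M) (g₀ : CuspForm (Gamma0 n₀) 2), IsNewform0 g₀ ∧
      ∀ q : ℕ, q.Prime → ¬ q ∣ n₀ * W.conductorNorm ℤ → cuspCoeff g₀ q = (W.LFunction q : ℂ) := by
  classical
  /- Step 0. The infinite set `P0` of primes `p ≥ p₀`, `p > M`. -/
  set B : ℕ := max p₀ (M + 1) with hB
  set P0 : Set ℕ := {p | p.Prime ∧ B ≤ p} with hP0
  have hP0inf : P0.Infinite := by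
    refine Set.infinite_of_not_bddAbove ?_
    rintro ⟨b, hb⟩
    obtain ⟨p, hle, hp⟩ := Nat.exists_infinite_primes (max B (b + 1))
    have hpP : p ∈ P0 := ⟨hp, le_of_max_le_left hle⟩
    have := hb hpP
    omega
  haveI hfact : ∀ p : P0, Fact (p : ℕ).Prime := fun p ↦ ⟨p.2.1⟩
  have hBp : ∀ p : P0, B ≤ (p : ℕ) := fun p ↦ p.2.2
  have hMp : ∀ p : P0, M < (p : ℕ) := fun p ↦
    lt_of_lt_of_le (Nat.lt_succ_self M) ((le_max_right _ _).trans (hBp p))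
  /- Step 1. For `p ∈ P0`: a framed model `ρ̄_p` of `E[p]` and the newform `f_p` of (3.3.1). -/
  have hdata : ∀ p : P0, ∃ (N : ℕ) (_ : NeZero N) (_ : N ≤ M) (f : CuspForm (Gamma1 N) 2)
      (K : Type) (_ : Field K) (_ : CharP K p) (_ : TopologicalSpace K)
      (j : ZMod p →+* K) (ι : coeffCharIntegers f →+* K) (ρ : ModPGaloisRep ℚ (ZMod p) 2),
      W.IsTorsionGaloisRep p ρ ∧ IsNewform1 f ∧
        IsGaloisRepOfNewform1Int f ι {q | q ∣ N * p}
          (FramedRep.baseChange j continuous_of_discreteTopology ρ) := by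
    intro p
    haveI : NeZero ((p : ℕ) : ℚ) := ⟨by exact_mod_cast p.2.1.ne_zero⟩
    obtain ⟨ρ, hρ⟩ := W.exists_isTorsionGaloisRep p
    obtain ⟨N, hN, hNM, f, K, hK, hKp, hKt, j, ι, hf, hgal⟩ :=
      h p ((le_max_left _ _).trans (hBp p)) ρ hρ
    exact ⟨N, hN, hNM, f, K, hK, hKp, hKt, j, ι, ρ, hρ, hf, hgal⟩
  choose N_ hN_ hNM_ f_ K_ hK_ hKp_ hKt_ j_ ι_ ρ_ hρ_ hf_ hgal_ using hdata
  /- Step 2. Comparison of Frobenius polynomials at a prime `q ∤ N_p p N_E`: the integral Hecke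
  polynomial `P` of `f_p` at `q` satisfies `ι(P₁) = -a_q(E)` and `ι(P₀) = q` in `K_p`. -/
  have hextract : ∀ (p : P0) (q : ℕ), q.Prime → ¬ q ∣ N_ p → q ≠ (p : ℕ) →
      ¬ q ∣ W.conductorNorm ℤ →
      ∃ P : Polynomial (coeffCharIntegers (f_ p)),
        P.map (algebraMap (coeffCharIntegers (f_ p)) (coeffCharField (f_ p))) =
            heckePolynomial (f_ p) q ∧
          ι_ p (P.coeff 1) = -((W.LFunction q : ℤ) : K_ p) ∧ ι_ p (P.coeff 0) = (q : K_ p) := by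
    intro p q hq hqN hqp hqE
    obtain ⟨v, rfl⟩ : ∃ v : HeightOneSpectrum (𝓞 ℚ), (primesEquiv v : ℕ) = q :=
      ⟨primesEquiv.symm ⟨q, hq⟩, by rw [Equiv.apply_symm_apply]⟩
    have hvS : ((primesEquiv v : Nat.Primes) : ℕ) ∉ {q | q ∣ N_ p * p} := by
      intro h'
      rcases (Nat.Prime.dvd_mul hq).mp h' with h1 | h1
      · exact hqN h1
      · exact hqp ((Nat.prime_dvd_prime_iff_eq hq p.2.1).mp h1)
    obtain ⟨-, P, hP, hch⟩ := hgal_ p v hvS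
    obtain ⟨𝔓, h𝔓⟩ := primesAbove_nonempty v
    obtain ⟨σ, hσ⟩ := exists_isArithFrobAt_of_mem_primesAbove_holds (v := v) h𝔓
    have hgood : W.HasGoodReductionAt v := by
      by_contra h'
      exact hqE ((W.dvd_conductorNorm_iff v).mpr h')
    have h1 := hch 𝔓 h𝔓 σ hσ
    rw [charpoly_baseChange_of_isTorsionGaloisRep W (hρ_ p) (j_ p) _ hqp hgood h𝔓 hσ] at h1
    refine ⟨P, hP, ?_, ?_⟩
    · have h2 := congrArg (fun Q : Polynomial (K_ p) ↦ Q.coeff 1) h1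
      simp only [Polynomial.coeff_map, coeff_add, coeff_sub, coeff_X_pow, coeff_C_mul,
        coeff_X_one, coeff_C_succ] at h2
      rw [← h2]
      simp
    · have h2 := congrArg (fun Q : Polynomial (K_ p) ↦ Q.coeff 0) h1
      simp only [Polynomial.coeff_map, coeff_add, coeff_sub, coeff_X_pow, coeff_C_mul,
        coeff_X_zero, coeff_C_zero] at h2
      rw [← h2]
      simp
  /- Step 3. For `p ∈ P0` (`p > M ≥ N_p`): `ε_{f_p} = 1`, and `f_p` descends to a newform
  `g_p ∈ S₂(Γ₀(N_p))` with the same `q`-expansion. -/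
  have hε : ∀ p : P0, nebentypus (f_ p) = 1 := by
    intro p
    refine nebentypus_eq_one_of_forall_prime (max (p : ℕ) (W.conductorNorm ℤ)) ?_
    intro q hq hqB hqN
    have hqp : q ≠ (p : ℕ) := fun h' ↦ (lt_of_le_of_lt (le_max_left _ _) hqB).ne' h'
    have hqE : ¬ q ∣ W.conductorNorm ℤ := fun h' ↦
      (Nat.le_of_dvd (conductorNorm_pos_holds W) h').not_gt (lt_of_le_of_lt (le_max_right _ _) hqB)
    obtain ⟨P, hP, -, h0⟩ := hextract p q hq hqN hqp hqE
    exact nebentypus_apply_eq_one_of_map_coeff_zero_eq hq hqN hP (ι_ p) hqp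
      ((hNM_ p).trans_lt (hMp p)) h0
  have hg : ∀ p : P0, ∃ g : CuspForm (Gamma0 (N_ p)) 2,
      IsNewform0 g ∧ (⇑g : UpperHalfPlane → ℂ) = ⇑(f_ p) := fun p ↦
    exists_isNewform0_coe_eq_of_nebentypus_eq_one (hf_ p) (hε p)
  choose g_ hg_ hgf_ using hg
  /- Step 4. "Il n'y a qu'un nombre fini de `F` possibles": pigeonhole over the finitely many
  pairs (level `≤ M`, newform on `Γ₀` of that level). -/
  set T : Set (ℕ × (UpperHalfPlane → ℂ)) :=
    ⋃ x : {n : ℕ // 0 < n ∧ n ≤ M},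
      (haveI : NeZero x.1 := ⟨x.2.1.ne'⟩;
        (fun g : CuspForm (Gamma0 x.1) 2 ↦ ((x.1 : ℕ), (⇑g : UpperHalfPlane → ℂ))) ''
          newforms0 x.1 2) with hT
  have hTfin : T.Finite := by
    haveI : Finite {n : ℕ // 0 < n ∧ n ≤ M} :=
      Set.Finite.to_subtype ((Set.finite_Iic M).subset fun n hn ↦ hn.2)
    refine Set.finite_iUnion fun x ↦ ?_
    haveI : NeZero x.1 := ⟨x.2.1.ne'⟩
    exact (finite_newforms0_holds x.1 2).image _
  have hΦ : ∀ p : P0, ((N_ p, (⇑(g_ p) : UpperHalfPlane → ℂ)) : ℕ × (UpperHalfPlane → ℂ)) ∈ T := by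
    intro p
    refine Set.mem_iUnion.mpr ⟨⟨N_ p, Nat.pos_of_ne_zero (NeZero.ne _), hNM_ p⟩, ?_⟩
    exact ⟨g_ p, hg_ p, rfl⟩
  haveI : Infinite P0 := hP0inf.to_subtype
  haveI : Finite T := hTfin.to_subtype
  obtain ⟨y, hy⟩ := Finite.exists_infinite_fiber
    (fun p : P0 ↦ (⟨(N_ p, (⇑(g_ p) : UpperHalfPlane → ℂ)), hΦ p⟩ : T))
  set P1 : Set P0 :=
    (fun p : P0 ↦ (⟨(N_ p, (⇑(g_ p) : UpperHalfPlane → ℂ)), hΦ p⟩ : T)) ⁻¹' {y} with hP1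
  have hP1inf : P1.Infinite := Set.infinite_coe_iff.mp hy
  obtain ⟨⟨n₀, hn₀pos, hn₀M⟩, hy'⟩ := Set.mem_iUnion.mp y.2
  haveI hn₀ : NeZero n₀ := ⟨hn₀pos.ne'⟩
  obtain ⟨g₀, hg₀, hy₀⟩ := hy'
  -- on the fibre: `N_p = n₀` and `g_p`, `f_p` have the `q`-expansion of `g₀`
  have hfib : ∀ p : P0, p ∈ P1 → N_ p = n₀ ∧ (⇑(f_ p) : UpperHalfPlane → ℂ) = ⇑g₀ := by
    intro p hp
    have h' : ((N_ p, (⇑(g_ p) : UpperHalfPlane → ℂ)) : ℕ × (UpperHalfPlane → ℂ)) = (n₀, ⇑g₀) := by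
      have := congrArg Subtype.val (show _ = y from hp)
      exact this.trans hy₀.symm
    obtain ⟨h1, h2⟩ := Prod.ext_iff.mp h'
    exact ⟨h1, (hgf_ p).symm.trans h2⟩
  /- Step 5. `a_q(g₀) = a_q(E)` for every prime `q ∤ n₀ N_E`: the algebraic integer
  `a_q(E) - a_q(g₀)` vanishes modulo `p` for the infinitely many `p ∈ P1`, `p ≠ q`. -/
  have hcoeff : ∀ q : ℕ, q.Prime → ¬ q ∣ n₀ * W.conductorNorm ℤ →
      cuspCoeff g₀ q = (W.LFunction q : ℂ) := by
    intro q hq hqM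
    have hqn : ¬ q ∣ n₀ := fun h' ↦ hqM (dvd_mul_of_dvd_left h' _)
    have hqE : ¬ q ∣ W.conductorNorm ℤ := fun h' ↦ hqM (dvd_mul_of_dvd_right h' _)
    -- the index set: `p ∈ P1`, `p ≠ q`
    set I : Set P0 := {p | p ∈ P1 ∧ (p : ℕ) ≠ q} with hI
    have hIlarge : ∀ n : ℕ, ∃ p : P0, p ∈ I ∧ n < (p : ℕ) := by
      intro n
      have hfin : {p : P0 | (p : ℕ) ≤ max n q}.Finite :=
        (Set.finite_Iic (max n q)).preimage Subtype.val_injective.injOn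
      obtain ⟨p, hp1, hp2⟩ := (hP1inf.sdiff hfin).nonempty
      simp only [Set.mem_setOf_eq, not_le] at hp2
      exact ⟨p, ⟨hp1, fun h' ↦ (lt_of_le_of_lt (le_max_right _ _) hp2).ne' h'⟩,
        lt_of_le_of_lt (le_max_left _ _) hp2⟩
    -- for `p ∈ I`: the integral element `x_p = P₁ + a_q(E) ∈ 𝓞_{f_p}` with `x_p ↦ ξ` in `ℂ` and
    -- `ι_p(x_p) = 0`
    set ξ : ℂ := -cuspCoeff g₀ q + (W.LFunction q : ℂ) with hξ
    have hx : ∀ i : I, ∃ x : coeffCharIntegers (f_ i.1),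
        (algebraMap (coeffCharField (f_ i.1)) ℂ)
            ((algebraMap (coeffCharIntegers (f_ i.1)) (coeffCharField (f_ i.1))) x) = ξ ∧
          ι_ i.1 x = 0 := by
      rintro ⟨p, hpP1, hpq⟩
      obtain ⟨hNp, hfp⟩ := hfib p hpP1
      obtain ⟨P, hP, h1, -⟩ := hextract p q hq (hNp ▸ hqn) hpq.symm hqE
      refine ⟨P.coeff 1 + ((W.LFunction q : ℤ) : coeffCharIntegers (f_ p)), ?_, ?_⟩
      · rw [map_add, map_add, (coeff_of_map_eq_heckePolynomial hP).1, map_intCast, map_intCast, hξ,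
          cuspCoeff, hfp]
      · rw [map_add, h1, map_intCast, neg_add_cancel]
    choose x_ hxξ_ hxι_ using hx
    have hξ0 : ξ = 0 := by
      obtain ⟨p1, hp1, -⟩ := hIlarge 0
      have hint : IsIntegral ℤ ξ := by
        rw [← hxξ_ ⟨p1, hp1⟩]
        exact (isIntegral_coeffCharField_iff _).mp (x_ ⟨p1, hp1⟩).2
      refine eq_zero_of_isIntegral_of_forall_exists_map_eq_zero hint (fun i : I ↦ ((i : P0) : ℕ))
        (fun i ↦ coeffCharIntegers (f_ i.1))
        (fun i ↦ (algebraMap (coeffCharField (f_ i.1)) ℂ).comp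
          (algebraMap (coeffCharIntegers (f_ i.1)) (coeffCharField (f_ i.1))))
        (fun i ↦ algebraMap_coeffCharIntegers_complex_injective (f_ i.1)) x_
        (fun i ↦ hxξ_ i) (fun i ↦ K_ i.1) (fun i ↦ ι_ i.1) hxι_ fun n ↦ ?_
      obtain ⟨p, hp, hnp⟩ := hIlarge n
      exact ⟨⟨p, hp⟩, hnp⟩
    have := hξ0
    rw [hξ, neg_add_eq_zero] at this
    exact this
  exact ⟨n₀, hn₀, hn₀M, g₀, hg₀, hcoeff⟩

/-- **Serre's Théorème 4 for `L(E, s)`: `L(E, s)` is entire, granted Eichler–Shimura and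
Faltings**, from the hypothesis of Part B (for all `p ≥ p₀`, `ρ̄_{E,p} ⊗ K` arises from a
newform of weight `2` and level `≤ M`).  Steps 0–5
(`exists_isNewform0_cuspCoeff_eq_off_of_forall_isTorsionGaloisRep_exists_isNewform1`) and the
Carayol-free ending
(`hasEntireLFunction_of_isNewform0_of_cuspCoeff_eq_off_of_eichlerShimura_of_faltings`, with
`R = N_E`).  Compare `isModular_of_forall_isTorsionGaloisRep_exists_isNewform1_of_three_facts`
(conclusion `IsModular W`, which needs Carayol).
[cite: Serre1987, §4.6, Théorème 4] [cite: BCDTJAMS2001, Introduction p. 845, (2) with Hecke] -/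
theorem hasEntireLFunction_of_forall_isTorsionGaloisRep_exists_isNewform1_of_eichlerShimura_of_faltings
    (hES : eichlerShimuraConstruction)
    (hF : WeierstrassCurve.isIsogenous_iff_frobeniusTrace_eq)
    (W : WeierstrassCurve ℚ) [W.IsElliptic] (M p₀ : ℕ)
    (h : ∀ (p : ℕ) [Fact p.Prime], p₀ ≤ p →
      ∀ ρ : ModPGaloisRep ℚ (ZMod p) 2, W.IsTorsionGaloisRep p ρ →
        ∃ (N : ℕ) (_ : NeZero N) (_ : N ≤ M) (f : CuspForm (Gamma1 N) 2)
          (K : Type) (_ : Field K) (_ : CharP K p) (_ : TopologicalSpace K)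
          (j : ZMod p →+* K) (ι : coeffCharIntegers f →+* K),
          IsNewform1 f ∧
            IsGaloisRepOfNewform1Int f ι {q | q ∣ N * p}
              (FramedRep.baseChange j continuous_of_discreteTopology ρ)) :
    W.HasEntireLFunction := by
  obtain ⟨n₀, hn₀, -, g₀, hg₀, hcoeff⟩ :=
    exists_isNewform0_cuspCoeff_eq_off_of_forall_isTorsionGaloisRep_exists_isNewform1 W M p₀ h
  haveI : NeZero (W.conductorNorm ℤ) := NeZero.of_pos (conductorNorm_pos_holds W)
  exact hasEntireLFunction_of_isNewform0_of_cuspCoeff_eq_off_of_eichlerShimura_of_faltings hES hF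
    W hg₀ (R := W.conductorNorm ℤ) hcoeff

/-! ## Part C. From Khare–Wintenberger, the Serre weight and the Serre level of `ρ̄_{E,p}` -/

section KhareWintenberger

open ValuativeRel GaloisRepresentations.ModPGaloisRep GaloisRepresentations.IsNonarchimedeanLocalField

/-- **Per curve: `L(E, s)` is entire along Serre's road.**  For an elliptic `W / ℚ`: if for all
primes `p ≥ p₀` Serre's conjecture (3.2.4) holds at `p` (`khare_wintenberger p k`,
Khare–Wintenberger 2009 Thms. 1.2 / 9.1), `k(ρ̄_{E,p} ⊗ k) = 2` (`hwt`, Serre 1987 §2.8 Prop. 4)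
and `N(ρ̄_{E,p} ⊗ k) ∣ N_E` (`hlev`, Serre 1987 (4.6.3)), then, granted Eichler–Shimura (`hES`)
and Faltings (`hF`), `L(E, s)` is entire
(`forall_isTorsionGaloisRep_exists_isNewform1_of_khare_wintenberger`, in which the irreducibility
(4.6.2) of `E[p]` for large `p` and `det ρ̄_{E,p} = χ̄_p` (4.6.1) are theorems of the tree, then
`hasEntireLFunction_of_forall_isTorsionGaloisRep_exists_isNewform1_of_eichlerShimura_of_faltings`
with `M = N_E`).  No Carayol, no modularity lifting theorem.
[cite: Serre1987, §4.6, Théorème 4 with Lemme 5]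
[cite: KhareWintenberger2009, Thm. 1.2, Thm. 9.1 and §10, Thm. 10.1 (i)] -/
theorem hasEntireLFunction_of_khare_wintenberger_of_serreWeight_of_serreLevel_of_eichlerShimura_of_faltings
    (hES : eichlerShimuraConstruction)
    (hF : WeierstrassCurve.isIsogenous_iff_frobeniusTrace_eq)
    (W : WeierstrassCurve ℚ) [W.IsElliptic] (p₀ : ℕ)
    (hKW : ∀ (p : ℕ) [Fact p.Prime], p₀ ≤ p →
      ∀ (k : Type) [Field k] [TopologicalSpace k] [DiscreteTopology k], khare_wintenberger p k)
    (hwt : ∀ (p : ℕ) [Fact p.Prime], p₀ ≤ p →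
      ∀ ρ : ModPGaloisRep ℚ (ZMod p) 2, W.IsTorsionGaloisRep p ρ →
        ∀ (k : Type) [Field k] [TopologicalSpace k] [DiscreteTopology k] [CharP k p]
          [IsAlgClosed k] (j : ZMod p →+* k)
          (loc : LocalRestrictionAt p (FramedRep.baseChange j continuous_of_discreteTopology ρ))
          (ι : absIntegers 𝒪[loc.F] loc.F ⧸ absMaximalIdeal loc.F →+* k),
          serreWeight p (FramedRep.baseChange j continuous_of_discreteTopology ρ) loc ι = 2)
    (hlev : ∀ (p : ℕ) [Fact p.Prime], p₀ ≤ p →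
      ∀ ρ : ModPGaloisRep ℚ (ZMod p) 2, W.IsTorsionGaloisRep p ρ →
        ∀ (k : Type) [Field k] [TopologicalSpace k] [DiscreteTopology k] [CharP k p]
          [IsAlgClosed k] (j : ZMod p →+* k),
          serreLevel p (FramedRep.baseChange j continuous_of_discreteTopology ρ) ∣
            W.conductorNorm ℤ) :
    W.HasEntireLFunction := by
  obtain ⟨p₁, h⟩ :=
    forall_isTorsionGaloisRep_exists_isNewform1_of_khare_wintenberger W p₀ hKW hwt hlev
  exact hasEntireLFunction_of_forall_isTorsionGaloisRep_exists_isNewform1_of_eichlerShimura_of_faltings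
    hES hF W (W.conductorNorm ℤ) p₁ fun p _ hp ρ hρ ↦ h p hp ρ hρ

/-- **`L(E, s)` is entire for every `E / ℚ` along Serre's road (Serre 1987, §4.6, Théorème 4,
with (3.3.1) supplied by Khare–Wintenberger), without Carayol.**  Trust base of
`WeierstrassCurve.hasEntireLFunction_rat` recorded by this theorem:
{`khare_wintenberger p k` (all primes `p`, all discrete `k`), the Serre weight
`k(ρ̄_{E,p} ⊗ k) = 2` and the Serre level `N(ρ̄_{E,p} ⊗ k) ∣ N_E` of `E[p]` for every `E` and all
large `p` (hypotheses `hwt`, `hlev`: Serre 1987 §2.8 Prop. 4 and (4.6.3)),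
`eichlerShimuraConstruction`, `WeierstrassCurve.isIsogenous_iff_frobeniusTrace_eq`} — one named
fact (Carayol, `IsNewformOf.level_eq_conductorNorm`) fewer than the Modularity Theorem
`exists_isNewformOf` along the same road
(`exists_isNewformOf_of_khare_wintenberger_of_serreWeight_of_serreLevel_of_three_facts`), and no
modularity lifting theorem (Wiles / Taylor–Wiles / Conrad–Diamond–Taylor / BCDT).
[cite: Serre1987, §4.6, Théorème 4]
[cite: KhareWintenberger2009, Thm. 1.2, Thm. 9.1 and §10, Thm. 10.1 (i)]
[cite: BCDTJAMS2001, Theorem A and Introduction p. 845, (1)–(2)] -/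
theorem _root_.WeierstrassCurve.hasEntireLFunction_rat_of_khare_wintenberger_of_serreWeight_of_serreLevel_of_eichlerShimura_of_faltings
    (hKW : ∀ (p : ℕ) [Fact p.Prime] (k : Type) [Field k] [TopologicalSpace k] [DiscreteTopology k],
      khare_wintenberger p k)
    (hwt : ∀ (W : WeierstrassCurve ℚ) [W.IsElliptic], ∃ p₀ : ℕ, ∀ (p : ℕ) [Fact p.Prime], p₀ ≤ p →
      ∀ ρ : ModPGaloisRep ℚ (ZMod p) 2, W.IsTorsionGaloisRep p ρ →
        ∀ (k : Type) [Field k] [TopologicalSpace k] [DiscreteTopology k] [CharP k p]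
          [IsAlgClosed k] (j : ZMod p →+* k)
          (loc : LocalRestrictionAt p (FramedRep.baseChange j continuous_of_discreteTopology ρ))
          (ι : absIntegers 𝒪[loc.F] loc.F ⧸ absMaximalIdeal loc.F →+* k),
          serreWeight p (FramedRep.baseChange j continuous_of_discreteTopology ρ) loc ι = 2)
    (hlev : ∀ (W : WeierstrassCurve ℚ) [W.IsElliptic], ∃ p₀ : ℕ, ∀ (p : ℕ) [Fact p.Prime],
      p₀ ≤ p → ∀ ρ : ModPGaloisRep ℚ (ZMod p) 2, W.IsTorsionGaloisRep p ρ →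
        ∀ (k : Type) [Field k] [TopologicalSpace k] [DiscreteTopology k] [CharP k p]
          [IsAlgClosed k] (j : ZMod p →+* k),
          serreLevel p (FramedRep.baseChange j continuous_of_discreteTopology ρ) ∣
            W.conductorNorm ℤ)
    (hES : eichlerShimuraConstruction)
    (hF : WeierstrassCurve.isIsogenous_iff_frobeniusTrace_eq) :
    hasEntireLFunction_rat := by
  intro W _
  obtain ⟨a, ha⟩ := hwt W
  obtain ⟨b, hb⟩ := hlev W
  exact hasEntireLFunction_of_khare_wintenberger_of_serreWeight_of_serreLevel_of_eichlerShimura_of_faltings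
    hES hF W (max a b) (fun p _ _ k _ _ _ ↦ hKW p k)
    (fun p _ hp ρ hρ k _ _ _ _ _ j loc ι ↦ ha p ((le_max_left a b).trans hp) ρ hρ k j loc ι)
    (fun p _ hp ρ hρ k _ _ _ _ _ j ↦ hb p ((le_max_right a b).trans hp) ρ hρ k j)

/-- **For the record: `L(E, s)` entire from BCDT Theorem A along Serre's road with Carayol**
(the tree's `exists_isNewformOf_of_khare_wintenberger_of_serreWeight_of_serreLevel_of_three_facts`
composed with the Hecke layer `hasEntireLFunction_rat_of_exists_isNewformOf`); trust base
{`khare_wintenberger`, `hwt`, `hlev`, `eichlerShimuraConstruction`,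
`WeierstrassCurve.isIsogenous_iff_frobeniusTrace_eq`, `IsNewformOf.level_eq_conductorNorm`}.
The previous theorem shows that the last entry is superfluous for this fact.
[cite: Serre1987, §4.6, Théorème 4 and Remarque (2)]
[cite: BCDTJAMS2001, Theorem A] -/
theorem _root_.WeierstrassCurve.hasEntireLFunction_rat_of_khare_wintenberger_of_serreWeight_of_serreLevel_of_three_facts
    (hKW : ∀ (p : ℕ) [Fact p.Prime] (k : Type) [Field k] [TopologicalSpace k] [DiscreteTopology k],
      khare_wintenberger p k)
    (hwt : ∀ (W : WeierstrassCurve ℚ) [W.IsElliptic], ∃ p₀ : ℕ, ∀ (p : ℕ) [Fact p.Prime], p₀ ≤ p →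
      ∀ ρ : ModPGaloisRep ℚ (ZMod p) 2, W.IsTorsionGaloisRep p ρ →
        ∀ (k : Type) [Field k] [TopologicalSpace k] [DiscreteTopology k] [CharP k p]
          [IsAlgClosed k] (j : ZMod p →+* k)
          (loc : LocalRestrictionAt p (FramedRep.baseChange j continuous_of_discreteTopology ρ))
          (ι : absIntegers 𝒪[loc.F] loc.F ⧸ absMaximalIdeal loc.F →+* k),
          serreWeight p (FramedRep.baseChange j continuous_of_discreteTopology ρ) loc ι = 2)
    (hlev : ∀ (W : WeierstrassCurve ℚ) [W.IsElliptic], ∃ p₀ : ℕ, ∀ (p : ℕ) [Fact p.Prime],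
      p₀ ≤ p → ∀ ρ : ModPGaloisRep ℚ (ZMod p) 2, W.IsTorsionGaloisRep p ρ →
        ∀ (k : Type) [Field k] [TopologicalSpace k] [DiscreteTopology k] [CharP k p]
          [IsAlgClosed k] (j : ZMod p →+* k),
          serreLevel p (FramedRep.baseChange j continuous_of_discreteTopology ρ) ∣
            W.conductorNorm ℤ)
    (hES : eichlerShimuraConstruction)
    (hF : WeierstrassCurve.isIsogenous_iff_frobeniusTrace_eq)
    (hC : ∀ (N : ℕ) [NeZero N], IsNewformOf.level_eq_conductorNorm (N := N)) :
    hasEntireLFunction_rat :=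
  hasEntireLFunction_rat_of_exists_isNewformOf
    (exists_isNewformOf_of_khare_wintenberger_of_serreWeight_of_serreLevel_of_three_facts hKW hwt
      hlev hES hF hC)

end KhareWintenberger

end Literature.NumberTheory.Automorphic.BCDT

end
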